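import Summits.CriticalPhenomena.PercolationContinuityZ3.Theorems.FK.PositiveFieldPlusFreeAgreement
import Literature.Probability.LatticeModels.MeanFieldLowerBound
import Literature.Probability.LatticeModels.MagnetizationExponentUpper
import HarnessLib

/-!
# SATURATION: `tanh(βh) ≤ ⟨σ_0⟩_{β,h}`, `m(β,h)^{|A|} ≤ ⟨σ_A⟩⁺_{β,h}`, AND EVERY CORRELATION TENDS TO `1` AS `h → ∞` OR `β → ∞`
# (Griffiths / GKS comparison with a single site; Friedli–Velenik 2017, Exercise 3.12, Thm. 3.20, Lemma 3.31)

Claimed R42 (8)(c) in the cell INBOX at 2026-08-29T02:34:07Z by fkp-10a gen 357 (NEW CLAIM of the gen, the sixth row asked this gen), addressed to coordinator fk-4 gen 288 (seated 01:00Z 2026-08-29 by l.8634; R160 – R164 in force); lineage row FO-10a-g357s2 (self-suggested), package g357-saturation, label SA-A.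
Helper file of the `fk-continuity` build cell (bschramm lane; `--supports stmt-CriticalPhenomena-4575`); builds on
p205010 (kernel theorem, internal audit signed; external expert review pending). No definitions, no named facts, no
sorries; standard axioms. UNCONDITIONAL (nearest-neighbour Ising model on `ℤ^d`, every `d`, `β > 0`, `h ≥ 0`).

GKS II volume monotonicity from the single site `{0}` (where `⟨σ_0⟩_{{0};β,h} = tanh(βh)`: tree theorems
`isingCorr_free_singleton_self`, `tanh_le_dctMagInf`, `MeanFieldLowerBound`) bounds the free one-point function below by
`tanh(βh)`; `⟨·⟩^∅ ≤ ⟨·⟩⁺` and the product inequality `⟨σ_A⟩⟨σ_B⟩ ≤ ⟨σ_{A∆B}⟩` (`plusCorr_mul_le`, `freeCorr_mul_le`)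
propagate it to all spin products; since everything is `≤ 1`, all correlations saturate as the field or the inverse
temperature tends to infinity:

* **`tanh_mul_le_freeCorr_singleton`**, **`tanh_mul_le_magnetizationInField`** — `tanh(βh) ≤ ⟨σ_0⟩^∅_{β,h} ≤ m(β,h)`
  (`β > 0`, `h ≥ 0`); the consequence `m(β,h) > 0` for `h > 0` is already the tree's
  `Summit.CriticalPhenomena.Ising3DConformalLimit.Theorems.MagneticRuler.magnetizationInField_pos` (not restated);
* `magnetizationInField_pow_le_plusCorr` — `m(β,h)^{|A|} ≤ ⟨σ_A⟩⁺_{β,h}` (GKS II `plusCorr_mul_le`, translation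
  invariance); hence `tanh_mul_pow_le_plusCorr`; `tendsto_tanh_mul_atTop`, `tendsto_tanh_mul_atTop_beta`
  (elementary: `tanh x = 1 − 2/(e^{2x}+1) → 1`, kept as local `have`s);
* **`tendsto_magnetizationInField_atTop_field`** — `m(β,h) → 1` as `h → ∞` (`β > 0`);
  **`tendsto_plusCorr_atTop_field`** / `tendsto_freeCorr_atTop_field` — `⟨σ_A⟩^{±∅}_{β,h} → 1` as `h → ∞` for every
  finite `A`: the state converges to the Dirac mass at the all-plus configuration on local observables;
* **`tendsto_magnetizationInField_atTop_beta`**, `tendsto_plusCorr_atTop_beta` — for fixed `h > 0`, `m(β,h) → 1` and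
  `⟨σ_A⟩⁺_{β,h} → 1` as `β → ∞` (ground-state saturation in a field).

## References

* S. Friedli, Y. Velenik, *Statistical Mechanics of Lattice Systems*, CUP (2017), Thm. 3.20 (GKS), Exercise 3.12,
  Lemma 3.31, §3.7. [FriedliVelenik2017]
* D. G. Kelly, S. Sherman, *General Griffiths' inequalities on correlations in Ising ferromagnets*, J. Math. Phys. 9
  (1968) 466–484. [KellySherman1968]
-/

noncomputable section

namespace Summit.CriticalPhenomena.PercolationContinuityZ3.Theorems.FK

namespace IsingSusceptibility

open MeasureTheory Filter Topology Finset Set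
open scoped symmDiff
open Literature.Probability.LatticeModels

variable {d : ℕ}

/-! ### The single-site lower bound -/

/-- **`tanh(βh) ≤ ⟨σ_0⟩^∅_{β,h}`** for `β > 0`, `h ≥ 0` (GKS II volume monotonicity from the single site, where the
one-point function is `tanh(βh)`; tree theorem `tanh_le_dctMagInf` in the parametrisation `dctMagInf d β k = ⟨σ_0⟩^∅_{β,k/β}`).
[cite: FriedliVelenik2017, Exercise 3.12 and Thm. 3.20] -/
theorem tanh_mul_le_freeCorr_singleton {β h : ℝ} (hβ : 0 < β) (hh : 0 ≤ h) :
    Real.tanh (β * h) ≤ freeCorr d β h {0} := by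
  have := tanh_le_dctMagInf (d := d) hβ (mul_nonneg hβ.le hh)
  rwa [dctMagInf, mul_div_cancel_left₀ h hβ.ne'] at this

/-- **`tanh(βh) ≤ m(β,h)`** for `β > 0`, `h ≥ 0` (`⟨σ_0⟩^∅ ≤ ⟨σ_0⟩⁺`). [cite: FriedliVelenik2017, Exercise 3.12, Thm. 3.20 and Lemma 3.31] -/
theorem tanh_mul_le_magnetizationInField {β h : ℝ} (hβ : 0 < β) (hh : 0 ≤ h) :
    Real.tanh (β * h) ≤ magnetizationInField d β h := by
  rw [magnetizationInField_eq_plusCorr]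
  exact (tanh_mul_le_freeCorr_singleton hβ hh).trans (freeCorr_le_plusCorr hβ.le hh _)

/-! ### Products: `m(β,h)^{|A|} ≤ ⟨σ_A⟩⁺_{β,h}` -/

/-- **`m(β,h)^{|A|} ≤ ⟨σ_A⟩⁺_{β,h}`** for every finite `A` (`β, h ≥ 0`): GKS II `⟨σ_x⟩⟨σ_B⟩ ≤ ⟨σ_{{x}∆B}⟩`
(`plusCorr_mul_le`) by induction on `A`, with translation invariance `⟨σ_x⟩⁺ = ⟨σ_0⟩⁺`.
[cite: FriedliVelenik2017, Thm. 3.20 (GKS II) and Thm. 3.17] -/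
theorem magnetizationInField_pow_le_plusCorr {β h : ℝ} (hβ : 0 ≤ β) (hh : 0 ≤ h) (A : Finset (Site d)) :
    magnetizationInField d β h ^ #A ≤ plusCorr d β h A := by
  classical
  induction A using Finset.induction_on with
  | empty => simp [plusCorr_empty hβ hh]
  | insert x A hx ih =>
    rw [card_insert_of_notMem hx, pow_succ, mul_comm]
    have hsd : ({x} : Finset (Site d)) ∆ A = insert x A := by
      ext y
      simp only [Finset.mem_symmDiff, Finset.mem_singleton, Finset.mem_insert]
      constructor
      · rintro (⟨rfl, -⟩ | ⟨hy, -⟩)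
        · exact Or.inl rfl
        · exact Or.inr hy
      · rintro (rfl | hy)
        · exact Or.inl ⟨rfl, hx⟩
        · exact Or.inr ⟨hy, fun h' => hx (h' ▸ hy)⟩
    have hm : magnetizationInField d β h = plusCorr d β h {x} := by
      have hx0 : ({0} : Finset (Site d)).map (Site.shift x).toEmbedding = {x} := by
        rw [Finset.map_singleton]
        simp [Site.shift]
      rw [magnetizationInField_eq_plusCorr, ← hx0, plusCorr_shift d hβ hh]
    have hm0 : 0 ≤ magnetizationInField d β h := by
      rw [magnetizationInField_eq_plusCorr]; exact plusCorr_nonneg hβ hh _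
    calc magnetizationInField d β h * magnetizationInField d β h ^ #A
        ≤ plusCorr d β h {x} * plusCorr d β h A := by
          rw [← hm]; exact mul_le_mul_of_nonneg_left ih hm0
      _ ≤ plusCorr d β h ({x} ∆ A) := plusCorr_mul_le hβ hh _ _
      _ = plusCorr d β h (insert x A) := by rw [hsd]

/-- **`tanh(βh)^{|A|} ≤ ⟨σ_A⟩⁺_{β,h}`** for every finite `A` (`β > 0`, `h ≥ 0`). [cite: FriedliVelenik2017, Thm. 3.20 and Exercise 3.12] -/
theorem tanh_mul_pow_le_plusCorr {β h : ℝ} (hβ : 0 < β) (hh : 0 ≤ h) (A : Finset (Site d)) :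
    Real.tanh (β * h) ^ #A ≤ plusCorr d β h A := by
  have htanh : 0 ≤ Real.tanh (β * h) := by
    rw [Real.tanh_eq_sinh_div_cosh]
    exact div_nonneg (Real.sinh_nonneg_iff.2 (mul_nonneg hβ.le hh)) (Real.cosh_pos _).le
  exact (pow_le_pow_left₀ htanh (tanh_mul_le_magnetizationInField hβ hh) _).trans
    (magnetizationInField_pow_le_plusCorr hβ.le hh A)

/-! ### Saturation as `h → ∞` -/

/-- `tanh(βh) → 1` as `h → ∞` (`β > 0`). [folklore] -/
theorem tendsto_tanh_mul_atTop {β : ℝ} (hβ : 0 < β) : Tendsto (fun h : ℝ => Real.tanh (β * h)) atTop (𝓝 1) := by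
  -- `tanh x = 1 − 2/(e^{2x}+1) → 1` (the tree has these folklore facts in unrelated modules; kept local here)
  have htanh : ∀ x : ℝ, Real.tanh x = 1 - 2 / (Real.exp (2 * x) + 1) := fun x => by
    rw [Real.tanh_eq, Real.exp_neg, two_mul, Real.exp_add]
    have hpos := Real.exp_pos x
    field_simp
    ring
  have hlim : Tendsto Real.tanh atTop (𝓝 1) := by
    have h1 : Tendsto (fun x : ℝ => Real.exp (2 * x) + 1) atTop atTop :=
      tendsto_atTop_add_const_right _ 1 (Real.tendsto_exp_atTop.comp (tendsto_id.const_mul_atTop two_pos))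
    have h2 : Tendsto (fun x : ℝ => 1 - 2 / (Real.exp (2 * x) + 1)) atTop (𝓝 (1 - 0)) :=
      tendsto_const_nhds.sub (tendsto_const_nhds.div_atTop h1)
    rw [sub_zero] at h2
    exact h2.congr fun x => (htanh x).symm
  exact hlim.comp (tendsto_id.const_mul_atTop hβ)

/-- `tanh(βh) → 1` as `β → ∞` (`h > 0`). [folklore] -/
theorem tendsto_tanh_mul_atTop_beta {h : ℝ} (hh : 0 < h) : Tendsto (fun β : ℝ => Real.tanh (β * h)) atTop (𝓝 1) := by
  have := (tendsto_tanh_mul_atTop hh).comp tendsto_id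
  refine this.congr fun β => ?_
  simp [mul_comm]

/-- **`m(β,h) → 1` as `h → ∞`** (`β > 0`): squeeze between `tanh(βh)` and `1`. [cite: FriedliVelenik2017, Exercise 3.12 and §3.7] -/
theorem tendsto_magnetizationInField_atTop_field {β : ℝ} (hβ : 0 < β) :
    Tendsto (fun h => magnetizationInField d β h) atTop (𝓝 1) := by
  refine tendsto_of_tendsto_of_tendsto_of_le_of_le' (tendsto_tanh_mul_atTop hβ) tendsto_const_nhds ?_ ?_
  · filter_upwards [eventually_ge_atTop 0] with h hh
    exact tanh_mul_le_magnetizationInField hβ hh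
  · filter_upwards [eventually_ge_atTop 0] with h hh
    rw [magnetizationInField_eq_plusCorr]
    exact plusCorr_le_one hβ.le hh _

/-- **Every plus correlation saturates: `⟨σ_A⟩⁺_{β,h} → 1` as `h → ∞`** (`β > 0`, every finite `A`): the plus state
converges on local observables to the Dirac mass at the all-plus configuration. [cite: FriedliVelenik2017, Thm. 3.20 and §3.7] -/
theorem tendsto_plusCorr_atTop_field {β : ℝ} (hβ : 0 < β) (A : Finset (Site d)) :
    Tendsto (fun h => plusCorr d β h A) atTop (𝓝 1) := by
  have hpow : Tendsto (fun h : ℝ => Real.tanh (β * h) ^ #A) atTop (𝓝 1) := by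
    simpa using (tendsto_tanh_mul_atTop hβ).pow #A
  refine tendsto_of_tendsto_of_tendsto_of_le_of_le' hpow tendsto_const_nhds ?_ ?_
  · filter_upwards [eventually_ge_atTop 0] with h hh
    exact tanh_mul_pow_le_plusCorr hβ hh A
  · filter_upwards [eventually_ge_atTop 0] with h hh
    exact plusCorr_le_one hβ.le hh _

/-- **`⟨σ_A⟩^∅_{β,h} → 1` as `h → ∞`** (`d ≥ 1`, `β > 0`; free = plus at `h > 0`). [cite: FriedliVelenik2017, Thm. 3.25 (1) and Thm. 3.20] -/
theorem tendsto_freeCorr_atTop_field (hd : 1 ≤ d) {β : ℝ} (hβ : 0 < β) (A : Finset (Site d)) :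
    Tendsto (fun h => freeCorr d β h A) atTop (𝓝 1) := by
  refine (tendsto_plusCorr_atTop_field hβ A).congr' ?_
  filter_upwards [eventually_gt_atTop 0] with h hh
  exact (freeCorr_eq_plusCorr_of_pos_field hd hβ.le hh A).symm

/-! ### Saturation as `β → ∞` in a fixed positive field -/

/-- **`m(β,h) → 1` as `β → ∞`** for fixed `h > 0` (ground-state saturation: `tanh(βh) ≤ m(β,h) ≤ 1`).
[cite: FriedliVelenik2017, Exercise 3.12 and §3.7] -/
theorem tendsto_magnetizationInField_atTop_beta {h : ℝ} (hh : 0 < h) :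
    Tendsto (fun β => magnetizationInField d β h) atTop (𝓝 1) := by
  have htanh : Tendsto (fun β : ℝ => Real.tanh (β * h)) atTop (𝓝 1) := tendsto_tanh_mul_atTop_beta hh
  refine tendsto_of_tendsto_of_tendsto_of_le_of_le' htanh tendsto_const_nhds ?_ ?_
  · filter_upwards [eventually_gt_atTop 0] with β hβ
    exact tanh_mul_le_magnetizationInField hβ hh.le
  · filter_upwards [eventually_ge_atTop 0] with β hβ
    rw [magnetizationInField_eq_plusCorr]
    exact plusCorr_le_one hβ hh.le _

/-- **`⟨σ_A⟩⁺_{β,h} → 1` as `β → ∞`** for fixed `h > 0` and every finite `A`. [cite: FriedliVelenik2017, Thm. 3.20 and §3.7] -/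
theorem tendsto_plusCorr_atTop_beta {h : ℝ} (hh : 0 < h) (A : Finset (Site d)) :
    Tendsto (fun β => plusCorr d β h A) atTop (𝓝 1) := by
  have hpow : Tendsto (fun β : ℝ => Real.tanh (β * h) ^ #A) atTop (𝓝 1) := by
    simpa using (tendsto_tanh_mul_atTop_beta hh).pow #A
  refine tendsto_of_tendsto_of_tendsto_of_le_of_le' hpow tendsto_const_nhds ?_ ?_
  · filter_upwards [eventually_gt_atTop 0] with β hβ
    exact tanh_mul_pow_le_plusCorr hβ hh.le A
  · filter_upwards [eventually_ge_atTop 0] with β hβ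
    exact plusCorr_le_one hβ hh.le _

end IsingSusceptibility

end Summit.CriticalPhenomena.PercolationContinuityZ3.Theorems.FK

end
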